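import Mathlib.Analysis.SpecialFunctions.Pow.Complex
import Mathlib.Analysis.SpecialFunctions.Pow.Real
import Mathlib.Algebra.Polynomial.AlgebraMap
import HarnessLib

/-!
# The local Riemann hypothesis at a finite place: Srednicki's spectral polynomial

For the `p`-adic harmonic oscillator (`p ≠ 2`) and an excited state of level `N ≥ 1` with trivial
character, Kurlberg's modified local factor is, up to a zero-free denominator, the polynomial
`y^{2N} − α y^{2N−1} − λ α y + λ` in `y = p^{iE}` (`s = 1/2 + iE`), where `α = p^{-1/2}` and
`λ = λ_N = ±1` [cite: Srednicki2011, §3, numerator of (p/(p−1))⟨N|E,1⟩]. Srednicki observes that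
this polynomial is `det(y − U)` for an explicit `2N × 2N` unitary matrix `U`, so its zeros have
`|y| = 1`, i.e. `E ∈ ℝ`: the local Riemann hypothesis at `p` [cite: Srednicki2011, §3]
(the general statement, all eigenfunctions and characters, odd residue characteristic, is
Kurlberg's theorem, *A local Riemann hypothesis II*, Math. Z. 233 (2000)).

We prove the unit-circle statement for every `0 < α < 1` and `λ = ±1`
(`norm_eq_one_of_srednickiPoly_eq_zero`) by a Blaschke-factor comparison instead of the unitary
matrix: writing the polynomial as `y^{2N−1}(y − α) + λ(1 − α y)` and using
`|1 − αy|² − |y − α|² = (1 − α²)(1 − |y|²)`, a zero with `|y| < 1` or `|y| > 1` is impossible.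
Consequence (`re_eq_half_of_srednickiPoly_eq_zero`): with `y = p^{s − 1/2}` (`p > 1` real),
a zero forces `Re s = 1/2`.
-/

namespace Literature.NumberTheory.LFunctions

open Polynomial Complex

namespace LocalRH

/-- Srednicki's spectral polynomial at a finite place: `y^{2N} − α·y^{2N−1} − λα·y + λ`
(`α = p^{-1/2}`, `λ = ±1` the sign attached to the level-`N` eigenfunction).
[cite: Srednicki2011, §3, y^{2N} − αy^{2N−1} − λαy + λ = det(y − U)] -/
noncomputable def srednickiPoly (N : ℕ) (α lam : ℝ) : ℂ[X] :=
  X ^ (2 * N) - C (α : ℂ) * X ^ (2 * N - 1) - C ((lam * α : ℝ) : ℂ) * X + C (lam : ℂ)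

/-- The factorised form `y^{2N−1}(y − α) + λ(1 − αy)` of the spectral polynomial (`N ≥ 1`).
[cite: Srednicki2011, §3] -/
theorem eval_srednickiPoly {N : ℕ} (hN : 1 ≤ N) (α lam : ℝ) (y : ℂ) :
    (srednickiPoly N α lam).eval y =
      y ^ (2 * N - 1) * (y - α) + (lam : ℂ) * (1 - (α : ℂ) * y) := by
  obtain ⟨M, rfl⟩ := Nat.exists_eq_add_of_le hN
  simp only [srednickiPoly, eval_add, eval_sub, eval_mul, eval_pow, eval_C, eval_X]
  rw [show 2 * (1 + M) = (2 * (1 + M) - 1) + 1 by omega, pow_succ]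
  push_cast
  ring

/-- The Blaschke identity `|1 − αy|² − |y − α|² = (1 − α²)(1 − |y|²)`. [folklore] -/
private theorem normSq_one_sub_mul_sub (α : ℝ) (y : ℂ) :
    Complex.normSq (1 - (α : ℂ) * y) - Complex.normSq (y - α) =
      (1 - α ^ 2) * (1 - Complex.normSq y) := by
  simp only [Complex.normSq_apply, Complex.sub_re, Complex.sub_im, Complex.mul_re, Complex.mul_im,
    Complex.one_re, Complex.one_im, Complex.ofReal_re, Complex.ofReal_im]
  ring

/-- **Local Riemann hypothesis at a finite place, Srednicki's form** [cite: Srednicki2011, §3]: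
for `0 < α < 1`, `λ = ±1` and `N ≥ 1`, every zero `y` of `y^{2N} − αy^{2N−1} − λαy + λ` lies on the
unit circle. (Srednicki: the polynomial is the characteristic polynomial of a unitary matrix; here:
comparison of `|y|^{2N-1}|y − α|` with `|1 − αy|`.) -/
theorem norm_eq_one_of_srednickiPoly_eq_zero {N : ℕ} (hN : 1 ≤ N) {α lam : ℝ} (hα0 : 0 < α)
    (hα1 : α < 1) (hlam : lam = 1 ∨ lam = -1) {y : ℂ} (hy : (srednickiPoly N α lam).eval y = 0) :
    ‖y‖ = 1 := by
  rw [eval_srednickiPoly hN] at hy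
  -- |y|^{2N-1} |y - α| = |1 - α y|
  have hlam1 : |lam| = 1 := by
    rcases hlam with h | h <;> simp [h]
  have heq : ‖y‖ ^ (2 * N - 1) * ‖y - α‖ = ‖1 - (α : ℂ) * y‖ := by
    have : y ^ (2 * N - 1) * (y - α) = -((lam : ℂ) * (1 - (α : ℂ) * y)) := eq_neg_of_add_eq_zero_left hy
    have h2 := congrArg (fun z : ℂ => ‖z‖) this
    simpa [norm_mul, norm_neg, norm_pow, hlam1] using h2
  have hid := normSq_one_sub_mul_sub α y
  rw [Complex.normSq_eq_norm_sq, Complex.normSq_eq_norm_sq, Complex.normSq_eq_norm_sq] at hid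
  have hα2 : 0 < 1 - α ^ 2 := by nlinarith
  have hyα_pos : 0 < ‖y - α‖ ∨ y = α := by
    by_cases h : y = α
    · exact Or.inr h
    · exact Or.inl (norm_pos_iff.mpr (sub_ne_zero.mpr h))
  rcases lt_trichotomy ‖y‖ 1 with hlt | heq1 | hgt
  · -- |y| < 1 : |y|^{2N-1}|y-α| ≤ |y-α| < |1-αy|
    exfalso
    have h1 : ‖y‖ ^ (2 * N - 1) ≤ 1 := pow_le_one₀ (norm_nonneg _) hlt.le
    have h2 : ‖y - α‖ ^ 2 < ‖1 - (α : ℂ) * y‖ ^ 2 := by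
      have : 0 < (1 - α ^ 2) * (1 - ‖y‖ ^ 2) := mul_pos hα2 (by nlinarith [norm_nonneg y])
      linarith
    have h3 : ‖1 - (α : ℂ) * y‖ ≤ ‖y - α‖ := by
      rw [← heq]
      exact mul_le_of_le_one_left (norm_nonneg _) h1
    nlinarith [norm_nonneg (1 - (α : ℂ) * y), norm_nonneg (y - α)]
  · exact heq1
  · -- |y| > 1 : |1-αy| < |y-α| ≤ |y|^{2N-1}|y-α|
    exfalso
    have h1 : 1 ≤ ‖y‖ ^ (2 * N - 1) := one_le_pow₀ hgt.le
    have h2 : ‖1 - (α : ℂ) * y‖ ^ 2 < ‖y - α‖ ^ 2 := by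
      have : (1 - α ^ 2) * (1 - ‖y‖ ^ 2) < 0 :=
        mul_neg_of_pos_of_neg hα2 (by nlinarith [norm_nonneg y])
      linarith
    have h3 : ‖y - α‖ ≤ ‖1 - (α : ℂ) * y‖ := by
      rw [← heq]
      exact le_mul_of_one_le_left (norm_nonneg _) h1
    nlinarith [norm_nonneg (1 - (α : ℂ) * y), norm_nonneg (y - α)]

/-- **Spectral corollary** [cite: Srednicki2011, §3, "y = p^{iE} must have unit magnitude … E must be
real"]: for a real `p > 1` (`α = p^{-1/2}`), if `y = p^{s − 1/2}` is a zero of the spectral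
polynomial then `Re s = 1/2`. -/
theorem re_eq_half_of_srednickiPoly_eq_zero {N : ℕ} (hN : 1 ≤ N) {p : ℝ} (hp : 1 < p) {lam : ℝ}
    (hlam : lam = 1 ∨ lam = -1) {s : ℂ}
    (hs : (srednickiPoly N (p ^ (-(1 / 2 : ℝ))) lam).eval ((p : ℂ) ^ (s - 1 / 2)) = 0) :
    s.re = 1 / 2 := by
  have hp0 : 0 < p := lt_trans zero_lt_one hp
  have hα0 : 0 < p ^ (-(1 / 2 : ℝ)) := Real.rpow_pos_of_pos hp0 _
  have hα1 : p ^ (-(1 / 2 : ℝ)) < 1 :=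
    Real.rpow_lt_one_of_one_lt_of_neg hp (by norm_num)
  have h := norm_eq_one_of_srednickiPoly_eq_zero hN hα0 hα1 hlam hs
  rw [Complex.norm_cpow_eq_rpow_re_of_pos hp0] at h
  have hre : (s - 1 / 2).re = 0 := by
    by_contra hne
    rcases lt_or_gt_of_ne hne with hlt | hgt
    · exact absurd h (ne_of_lt (Real.rpow_lt_one_of_one_lt_of_neg hp hlt))
    · exact absurd h (ne_of_gt (Real.one_lt_rpow hp hgt))
  have : (s - 1 / 2).re = s.re - 1 / 2 := by simp
  linarith

end LocalRH

end Literature.NumberTheory.LFunctions
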